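import Mathlib.Analysis.InnerProductSpace.l2Space
import Mathlib.Analysis.InnerProductSpace.Adjoint
import Mathlib.Analysis.InnerProductSpace.Positive
import Mathlib.Analysis.InnerProductSpace.StarOrder
import Mathlib.Analysis.CStarAlgebra.ContinuousLinearMap
import Mathlib.Analysis.CStarAlgebra.Classes
import Mathlib.Analysis.Normed.Operator.ContinuousLinearMap
import Mathlib.Topology.Algebra.StarSubalgebra
import Mathlib.Algebra.Star.Subalgebra
import Mathlib.RingTheory.SimpleRing.Basic
import Literature.Probability.LatticeModels.LatticeGraph
import Literature.MathematicalPhysics.QuantumLattice.SpinSystem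
import Literature.MathematicalPhysics.QuantumLattice.LocalDynamics
import Literature.MathematicalPhysics.QuantumLattice.CStarState
import Literature.MathematicalPhysics.QuantumLattice.InfiniteVolumeStates
import Literature.MathematicalPhysics.QuantumLattice.QuasiLocalAlgebra
import HarnessLib

-- provenance: harness21/H21/H21/Prelude/AnalysisL/GuichardetUHF.lean @ a9f1ab0 (interim HEAD d8f2665); M5 mechanical rewrite
/-!
# The concrete quasi-local (UHF) algebra on the Guichardet space (trunk AnalysisL, item P5)

Notions `quasi_local_algebra`, `cstar_state_gns`. This file **constructs** the quasi-local
C⋆-algebra of the quantum spin system on `ℤ^d` with local dimension `q ≥ 1`, discharging the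
sorried existence theorem `QLattice.nonempty_quasiLocalAlgebra` of the accepted hypothesis
structure `QLattice.QuasiLocalAlgebra d q` (`Literature.Prelude.QLatticeAQFT.QuasiLocalAlgebra`).

Mathlib (pinned) has no C⋆-inductive limits and no UHF algebras, but the *spatial* construction
needs none: von Neumann's incomplete infinite tensor product `⊗_{x ∈ ℤ^d} (ℂ^q, e₀)` with respect
to the reference vector `e₀` (Guichardet 1966) is canonically `ℓ²` of the *finitely supported
configurations* `σ : ℤ^d → Fin q` (`σ x = 0` for all but finitely many `x`), the local matrix
algebras `𝔄_Λ = Op ↥Λ q` act on it by `A ⊗ 𝟙_{Λᶜ}`, and the quasi-local algebra is the norm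
closure in `B(ℓ²)` of the union of their (commuting, isotone) images. Lattice translations act by
the permutation unitaries `U_v`.

Contents (`namespace Literature.QLattice`):
* `FinSuppConfig d q`, `FinSuppConfig.restrict/splice/shift`; `GuichardetSpace d q := ℓ²`,
  `vacuumVector` (the infinite product vector `⊗ e₀`);
* `localRepFun`, `memℓp_localRepFun` (proved), `localRep Λ : Op ↥Λ q →⋆ₐ[ℂ] B(ℓ²)`,
  `localRep_injective`, `localRep_compatible`, `localRep_commute_of_disjoint`;
* `localAlgebra d q = ⨆ Λ, range (localRep Λ)`, `quasiLocalAlg d q` (its closure, a C⋆-algebra by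
  Mathlib's `StarSubalgebra.cstarAlgebra`), `starOrderedRing_quasiLocalAlg`, `localRepCod`,
  `dense_iUnion_range_localRepCod`;
* `shiftUnitary v` (proved isometry), `shiftAut v`, `shiftAut_localRepCod`;
* `uhfQuasiLocalAlgebra d q : QuasiLocalAlgebra d q`, `nonempty_quasiLocalAlgebra_of_uhf`;
* `vectorState`, `vacuumState`, `vacuumState_isPure`, `isSimpleRing_quasiLocalAlg` (Glimm).

## Sources

* J. von Neumann, *On infinite direct products*, Compositio Math. 6 (1939) 1–77.
* A. Guichardet, *Produits tensoriels infinis et représentations des relations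
  d'anticommutation*, Ann. Sci. ÉNS (3) 83 (1966) 1–52.
* O. Bratteli, D. W. Robinson, *Operator Algebras and Quantum Statistical Mechanics I* (2nd ed.,
  Springer 1987), §2.6.1 (quasi-local algebras), Example 2.6.12 (UHF algebras), Prop. 2.2.10
  (square roots of positive elements), §2.7.
* O. Bratteli, D. W. Robinson, *Operator Algebras and Quantum Statistical Mechanics II* (2nd
  ed., Springer 1997), §6.2.1 (quantum spin systems).
* J. Glimm, *On a certain class of operator algebras*, Trans. AMS 95 (1960) 318–340.

## Mathlib search and design notes

* Used from Mathlib: `lp (fun _ ↦ ℂ) 2` with `lp.instInnerProductSpace` (Hilbert space),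
  `lp.single`, `Memℓp`, `LinearMap.mkContinuousOfExistsBound`, `StarAlgHom.range`,
  `StarAlgHom.codRestrict`, `StarSubalgebra.topologicalClosure`,
  `StarSubalgebra.isClosed_topologicalClosure`, `StarSubalgebra.cstarAlgebra` (fires from the
  `IsClosed` instance `isClosed_quasiLocalAlg` on our set), the Loewner order
  `ContinuousLinearMap.instLoewnerPartialOrder` and `ContinuousLinearMap.instStarOrderedRing`
  on `B(H)`, `LinearIsometryEquiv`, `LinearIsometryEquiv.adjoint_eq_symm`, `IsSimpleRing`.
  `rg -i "guichardet|incomplete tensor|UHF"` in Mathlib finds nothing.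
* Order: `↥(quasiLocalAlg d q)` inherits the Loewner order of `B(H)` as a subtype; NO new
  `PartialOrder`/`StarOrderedRing` instance is declared. That this inherited order is the
  C⋆-order of the closed subalgebra (spectral permanence) is the named fact
  `starOrderedRing_quasiLocalAlg`, passed explicitly as the hypothesis `hsor` of
  `uhfQuasiLocalAlgebra` and as an instance hypothesis in `vacuumState_isPure`.
* Definitions with proof obligations: the data of `localRep`, `localRepCod`, `shiftUnitary`,
  `shiftAut`, `uhfQuasiLocalAlgebra`, `vectorState` are real; Prop obligations are discharged by
  named lemmas or enter as explicit hypotheses. The unproved ones are the named facts (`Prop`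
  definitions) `norm_localRepFun_le` (the sharp continuity bound `‖A‖`; a crude bound
  `norm_localRepVec_le_sum` is proved and used for `localRepCLM`), `localRep_map_star'` (the
  standing hypothesis `hstar` from `localRep` on), `localRep_injective`, `localRep_compatible`,
  `localRep_commute_of_disjoint`, `shift_mem_quasiLocalAlg`, `shiftAut_localRepCod`,
  `starOrderedRing_quasiLocalAlg`. `memℓp_localRepFun`, `localRep_map_one'/mul'/zero'/add'/
  smul'`, the isometry of `shiftUnitary`, `coe_localAlgebra`/`dense_iUnion_range_localRepCod`
  (from the hypothesis `localRep_compatible`) and the positivity of `vectorState` are proved.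
* `FinSuppConfig d q` gets `Zero`, `Inhabited` and a classical `DecidableEq` instance (it is a new
  type; `lp.single` needs decidable equality of the index).
-/

noncomputable section

open Matrix Complex Finset Filter Topology
open scoped Matrix.Norms.L2Operator ComplexOrder InnerProductSpace ENNReal

namespace Literature.Analysis.FunctionSpaces

section QLattice

open Literature.Probability.LatticeModels
open Literature.Probability.LatticeModels (Site)

variable (d q : ℕ) [NeZero q]

/-! ### Finitely supported configurations and the Guichardet space -/

/-- **Finitely supported configurations** `σ : ℤ^d → Fin q`, `σ x = 0` for all but finitely
many sites: the labels of the canonical orthonormal basis `⊗_x e_{σ x}` of von Neumann's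
incomplete infinite tensor product `⊗_{x∈ℤ^d} (ℂ^q, e₀)`. von Neumann (1939); Guichardet (1966);
Bratteli–Robinson I Example 2.6.12. [cite: Neumann1939] -/
def FinSuppConfig : Type :=
  {σ : Site d → Fin q // {x | σ x ≠ 0}.Finite}

namespace FinSuppConfig

variable {d q}

/-- The reference configuration `σ ≡ 0` (labels the product vector `⊗_x e₀`).
von Neumann (1939). [cite: Neumann1939] -/
instance instZero : Zero (FinSuppConfig d q) :=
  ⟨⟨fun _ => 0, by simp⟩⟩

/-- `FinSuppConfig d q` is inhabited by the reference configuration. von Neumann (1939). [cite: Neumann1939] -/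
instance instInhabited : Inhabited (FinSuppConfig d q) := ⟨0⟩

/-- Classical decidable equality of configurations (needed by `lp.single`). [folklore] -/
instance instDecidableEq : DecidableEq (FinSuppConfig d q) := Classical.typeDecidableEq _

/-- Two configurations are equal iff their underlying functions are. [folklore] -/
@[ext]
theorem ext {σ σ' : FinSuppConfig d q} (h : ∀ x, σ.1 x = σ'.1 x) : σ = σ' :=
  Subtype.ext (funext h)

/-- Restriction `σ|_Λ : ↥Λ → Fin q` of a configuration to a finite region (a `TensorIndex ↥Λ q`,
indexing the product basis of `𝓗_Λ`). Bratteli–Robinson II §6.2.1. [folklore] -/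
def restrict (Λ : Finset (Site d)) (σ : FinSuppConfig d q) : ↥Λ → Fin q :=
  fun x => σ.1 x

/-- **Splicing**: replace the configuration `σ` inside the finite region `Λ` by `τ : ↥Λ → Fin q`
(and keep it outside). The result is again finitely supported (support `⊆ Λ ∪ supp σ`).
Bratteli–Robinson II §6.2.1 (the factorisation `𝓗 = 𝓗_Λ ⊗ 𝓗_{Λᶜ}`). [folklore] -/
def splice (Λ : Finset (Site d)) (τ : ↥Λ → Fin q) (σ : FinSuppConfig d q) : FinSuppConfig d q :=
  ⟨fun x => if h : x ∈ Λ then τ ⟨x, h⟩ else σ.1 x,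
    ((Λ.finite_toSet).union σ.2).subset fun x hx => by
      by_cases h : x ∈ Λ
      · exact Or.inl h
      · right
        simpa [h] using hx⟩

/-- `splice` unfolded at a site. Bratteli–Robinson II §6.2.1. [folklore] -/
theorem splice_apply (Λ : Finset (Site d)) (τ : ↥Λ → Fin q) (σ : FinSuppConfig d q)
    (x : Site d) : (σ.splice Λ τ).1 x = if h : x ∈ Λ then τ ⟨x, h⟩ else σ.1 x := rfl

/-- Restricting a spliced configuration recovers the inserted block. Bratteli–Robinson II
§6.2.1. [folklore] -/
@[simp]
theorem restrict_splice (Λ : Finset (Site d)) (τ : ↥Λ → Fin q) (σ : FinSuppConfig d q) :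
    (σ.splice Λ τ).restrict Λ = τ := by
  funext x
  simp [restrict, splice_apply, x.2]

/-- Splicing a configuration with its own restriction does nothing. Bratteli–Robinson II
§6.2.1. [folklore] -/
@[simp]
theorem splice_restrict (Λ : Finset (Site d)) (σ : FinSuppConfig d q) :
    σ.splice Λ (σ.restrict Λ) = σ := by
  ext x
  simp only [splice_apply, restrict]
  split_ifs <;> rfl

/-- Splicing twice in the same region keeps the last block. Bratteli–Robinson II §6.2.1. [folklore] -/
@[simp]
theorem splice_splice (Λ : Finset (Site d)) (τ τ' : ↥Λ → Fin q) (σ : FinSuppConfig d q) :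
    (σ.splice Λ τ).splice Λ τ' = σ.splice Λ τ' := by
  ext x
  simp only [splice_apply]
  split_ifs <;> rfl

/-- A configuration is determined by its restriction to `Λ` and its splice by any fixed block:
`σ ↦ σ.splice Λ τ` is injective on each fibre `{σ | σ|_Λ = τ'}`. Bratteli–Robinson II §6.2.1. [folklore] -/
theorem splice_injOn (Λ : Finset (Site d)) (τ τ' : ↥Λ → Fin q) :
    Set.InjOn (fun σ : FinSuppConfig d q => σ.splice Λ τ) {σ | σ.restrict Λ = τ'} := by
  intro σ₁ h₁ σ₂ h₂ h
  rw [← splice_restrict Λ σ₁, ← splice_restrict Λ σ₂, h₁, h₂]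
  ext x
  have hx := congrArg (fun ρ : FinSuppConfig d q => ρ.1 x) h
  simp only [splice_apply] at hx ⊢
  split_ifs with hΛ
  · rfl
  · simp only [hΛ, dite_false] at hx
    rw [hx]

/-- Lattice translation of configurations, `(shift v σ) x = σ (x - v)` (so the support moves by
`+v`), as a bijection of `FinSuppConfig d q`. Bratteli–Robinson II §6.2.1, eq. (6.2.2). [folklore] -/
def shift (v : Site d) : FinSuppConfig d q ≃ FinSuppConfig d q where
  toFun σ := ⟨σ.1 ∘ (Site.shift v).symm,
    σ.2.preimage_embedding (Site.shift v).symm.toEmbedding⟩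
  invFun σ := ⟨σ.1 ∘ Site.shift v, σ.2.preimage_embedding (Site.shift v).toEmbedding⟩
  left_inv σ := by ext x; simp
  right_inv σ := by ext x; simp

/-- `shift` unfolded at a site. Bratteli–Robinson II §6.2.1. [folklore] -/
@[simp]
theorem shift_apply (v : Site d) (σ : FinSuppConfig d q) (x : Site d) :
    (shift v σ).1 x = σ.1 (x - v) := by
  simp [shift]

/-- `shift⁻¹` unfolded at a site. Bratteli–Robinson II §6.2.1. [folklore] -/
@[simp]
theorem shift_symm_apply (v : Site d) (σ : FinSuppConfig d q) (x : Site d) :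
    ((shift v).symm σ).1 x = σ.1 (x + v) := by
  simp [shift]

end FinSuppConfig

/-- The **Guichardet space** `𝓗 = ℓ²(FinSuppConfig d q)`: von Neumann's incomplete infinite
tensor product `⊗_{x∈ℤ^d} (ℂ^q, e₀)`, a Hilbert space (Mathlib `lp _ 2`,
`lp.instInnerProductSpace`). von Neumann (1939); Guichardet (1966); Bratteli–Robinson I
Example 2.6.12, II §6.2.1. [cite: Neumann1939] -/
abbrev GuichardetSpace : Type := lp (fun _ : FinSuppConfig d q => ℂ) 2

/-- The **vacuum (reference product) vector** `Ω = ⊗_x e₀ = δ_{σ ≡ 0}`. von Neumann (1939);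
Bratteli–Robinson II §6.2.1. [cite: Neumann1939] -/
def vacuumVector : GuichardetSpace d q :=
  lp.single 2 (0 : FinSuppConfig d q) (1 : ℂ)

/-- `‖Ω‖ = 1`. von Neumann (1939). [cite: Neumann1939] -/
theorem norm_vacuumVector : ‖vacuumVector d q‖ = 1 := by
  simp [vacuumVector, lp.norm_single]

/-! ### The local representations `π_Λ : 𝔄_Λ → B(𝓗)` -/

variable {d q}

/-- The action of a local observable `A ∈ 𝔄_Λ = Op ↥Λ q` on a vector `ψ ∈ 𝓗`, as a function of
configurations: `(A ⊗ 𝟙_{Λᶜ}) ψ (σ) = ∑_τ A(σ|_Λ, τ) ψ(σ with τ spliced into Λ)`.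
Bratteli–Robinson II §6.2.1 (`𝔄_Λ ≅ B(𝓗_Λ) ⊗ 𝟙`); Guichardet (1966). [cite: Guichardet1966] -/
def localRepFun (Λ : Finset (Site d)) (A : Literature.MathematicalPhysics.QuantumLattice.Op ↥Λ q) (ψ : GuichardetSpace d q) :
    FinSuppConfig d q → ℂ :=
  fun σ => ∑ τ : (↥Λ → Fin q), A (σ.restrict Λ) τ * ψ (σ.splice Λ τ)

/-- The elementary pieces of `localRepFun`: `ψ` reindexed along `σ ↦ σ.splice Λ τ` on the fibre
`{σ | σ|_Λ = τ'}` (where this map is injective) and `0` elsewhere is square summable.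
Guichardet (1966); Bratteli–Robinson II §6.2.1. [cite: Guichardet1966] -/
theorem memℓp_indicator_comp_splice (Λ : Finset (Site d)) (τ τ' : ↥Λ → Fin q)
    (ψ : GuichardetSpace d q) :
    Memℓp (fun σ : FinSuppConfig d q => if σ.restrict Λ = τ' then ψ (σ.splice Λ τ) else 0)
      2 := by
  set S : Set (FinSuppConfig d q) := {σ | σ.restrict Λ = τ'} with hS
  set F : FinSuppConfig d q → ℂ := fun σ => ψ (σ.splice Λ τ) with hF
  have hSF : (fun σ : FinSuppConfig d q => if σ.restrict Λ = τ' then ψ (σ.splice Λ τ) else 0) =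
      S.indicator F := by
    funext σ
    simp only [Set.indicator_apply, hS, hF, Set.mem_setOf_eq]
  rw [hSF]
  have hp : 0 < (2 : ℝ≥0∞).toReal := by norm_num
  have hψ := (lp.memℓp ψ).summable hp
  have hinj : Function.Injective (fun σ : S => (σ : FinSuppConfig d q).splice Λ τ) :=
    fun σ₁ σ₂ h => Subtype.ext ((FinSuppConfig.splice_injOn Λ τ τ') σ₁.2 σ₂.2 h)
  have h1 := hψ.comp_injective hinj
  have h2 : Summable (S.indicator fun σ => ‖F σ‖ ^ (2 : ℝ≥0∞).toReal) :=
    summable_subtype_iff_indicator.mp h1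
  refine memℓp_gen (h2.congr fun σ => ?_)
  simp only [Set.indicator_apply]
  split_ifs
  · rfl
  · rw [norm_zero, Real.zero_rpow hp.ne']

/-- **`localRepFun Λ A ψ` is square summable**: it is the finite linear combination
`∑_{τ,τ'} A τ' τ • (ψ reindexed along the injection σ ↦ σ.splice Λ τ of the fibre σ|_Λ = τ')`
of `ℓ²` vectors. Guichardet (1966); Bratteli–Robinson II §6.2.1. [cite: Guichardet1966] -/
theorem memℓp_localRepFun (Λ : Finset (Site d)) (A : Literature.MathematicalPhysics.QuantumLattice.Op ↥Λ q) (ψ : GuichardetSpace d q) :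
    Memℓp (localRepFun Λ A ψ) 2 := by
  have h : localRepFun Λ A ψ = fun σ => ∑ τ ∈ (univ : Finset (↥Λ → Fin q)),
      ∑ τ' ∈ (univ : Finset (↥Λ → Fin q)),
        (A τ' τ • fun ρ : FinSuppConfig d q =>
          if ρ.restrict Λ = τ' then ψ (ρ.splice Λ τ) else 0) σ := by
    funext σ
    simp only [localRepFun, Pi.smul_apply, smul_eq_mul, mul_ite, mul_zero,
      Finset.sum_ite_eq, Finset.mem_univ, if_true]
  rw [h]
  exact Memℓp.finsetSum _ fun τ _ => Memℓp.finsetSum _ fun τ' _ =>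
    (memℓp_indicator_comp_splice Λ τ τ' ψ).const_smul _

/-- `localRepFun Λ A ψ` as a vector of `𝓗`. Bratteli–Robinson II §6.2.1. [folklore] -/
def localRepVec (Λ : Finset (Site d)) (A : Literature.MathematicalPhysics.QuantumLattice.Op ↥Λ q) (ψ : GuichardetSpace d q) :
    GuichardetSpace d q :=
  ⟨localRepFun Λ A ψ, memℓp_localRepFun Λ A ψ⟩

/-- Coordinates of `localRepVec` (definitional). Bratteli–Robinson II §6.2.1. [folklore] -/
@[simp]
theorem localRepVec_apply (Λ : Finset (Site d)) (A : Literature.MathematicalPhysics.QuantumLattice.Op ↥Λ q) (ψ : GuichardetSpace d q)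
    (σ : FinSuppConfig d q) :
    localRepVec Λ A ψ σ = ∑ τ : (↥Λ → Fin q), A (σ.restrict Λ) τ * ψ (σ.splice Λ τ) := rfl

/-- `ψ ↦ (A ⊗ 𝟙) ψ` as a linear map of `𝓗`. Bratteli–Robinson II §6.2.1. [folklore] -/
def localRepLin (Λ : Finset (Site d)) (A : Literature.MathematicalPhysics.QuantumLattice.Op ↥Λ q) :
    GuichardetSpace d q →ₗ[ℂ] GuichardetSpace d q where
  toFun := localRepVec Λ A
  map_add' ψ ψ' := by
    ext σ
    simp [Finset.sum_add_distrib, mul_add]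
  map_smul' c ψ := by
    ext σ
    simp [Finset.mul_sum, mul_left_comm]

/-- **Boundedness**: `‖(A ⊗ 𝟙) ψ‖ ≤ ‖A‖ ‖ψ‖` for the L²-operator norm of `A` (decompose
`𝓗 = ⊕_{ρ} 𝓗_Λ` over the configurations `ρ` outside `Λ`; on each summand `A ⊗ 𝟙` acts as `A`).
Bratteli–Robinson II §6.2.1; Guichardet (1966). [cite: Guichardet1966] -/
def norm_localRepFun_le : Prop :=
  ∀ (Λ : Finset (Site d)) (A : Literature.MathematicalPhysics.QuantumLattice.Op ↥Λ q) (ψ : GuichardetSpace d q),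
    ‖localRepVec Λ A ψ‖ ≤ ‖A‖ * ‖ψ‖

/-- The elementary piece of `localRepFun` as a vector of `𝓗`: `ψ` reindexed along
`σ ↦ σ.splice Λ τ` on the fibre `{σ | σ|_Λ = τ'}` and `0` elsewhere. Guichardet (1966);
Bratteli–Robinson II §6.2.1. [cite: Guichardet1966] -/
def spliceVec (Λ : Finset (Site d)) (τ τ' : ↥Λ → Fin q) (ψ : GuichardetSpace d q) :
    GuichardetSpace d q :=
  ⟨fun σ => if σ.restrict Λ = τ' then ψ (σ.splice Λ τ) else 0,
    memℓp_indicator_comp_splice Λ τ τ' ψ⟩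

/-- Coordinates of `spliceVec` (definitional). [folklore] -/
@[simp]
theorem spliceVec_apply (Λ : Finset (Site d)) (τ τ' : ↥Λ → Fin q) (ψ : GuichardetSpace d q)
    (σ : FinSuppConfig d q) :
    spliceVec Λ τ τ' ψ σ = if σ.restrict Λ = τ' then ψ (σ.splice Λ τ) else 0 := rfl

/-- Each elementary piece is a contraction: `‖spliceVec Λ τ τ' ψ‖ ≤ ‖ψ‖` (the reindexing map is
injective on the fibre). Guichardet (1966); Bratteli–Robinson II §6.2.1. [cite: Guichardet1966] -/
theorem norm_spliceVec_le (Λ : Finset (Site d)) (τ τ' : ↥Λ → Fin q) (ψ : GuichardetSpace d q) :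
    ‖spliceVec Λ τ τ' ψ‖ ≤ ‖ψ‖ := by
  have hp : 0 < (2 : ℝ≥0∞).toReal := by norm_num
  refine lp.norm_le_of_forall_sum_le hp (norm_nonneg _) fun s => ?_
  calc ∑ σ ∈ s, ‖spliceVec Λ τ τ' ψ σ‖ ^ (2 : ℝ≥0∞).toReal
      = ∑ σ ∈ s.filter (fun σ => σ.restrict Λ = τ'),
          ‖ψ (σ.splice Λ τ)‖ ^ (2 : ℝ≥0∞).toReal := by
        rw [Finset.sum_filter]
        refine Finset.sum_congr rfl fun σ _ => ?_
        rw [spliceVec_apply]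
        split_ifs
        · rfl
        · rw [norm_zero, Real.zero_rpow hp.ne']
    _ = ∑ ρ ∈ (s.filter (fun σ => σ.restrict Λ = τ')).image (fun σ => σ.splice Λ τ),
          ‖ψ ρ‖ ^ (2 : ℝ≥0∞).toReal := by
        rw [Finset.sum_image]
        intro σ₁ h₁ σ₂ h₂ h
        exact FinSuppConfig.splice_injOn Λ τ τ' (Finset.mem_filter.1 h₁).2
          (Finset.mem_filter.1 h₂).2 h
    _ ≤ ‖ψ‖ ^ (2 : ℝ≥0∞).toReal := lp.sum_rpow_le_norm_rpow hp ψ _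

/-- `localRepVec` is the finite linear combination `∑_{τ,τ'} A τ' τ • spliceVec Λ τ τ' ψ`.
Guichardet (1966); Bratteli–Robinson II §6.2.1. [cite: Guichardet1966] -/
theorem localRepVec_eq_sum (Λ : Finset (Site d)) (A : Literature.MathematicalPhysics.QuantumLattice.Op ↥Λ q) (ψ : GuichardetSpace d q) :
    localRepVec Λ A ψ = ∑ τ : (↥Λ → Fin q), ∑ τ' : (↥Λ → Fin q), A τ' τ • spliceVec Λ τ τ' ψ := by
  ext σ
  simp only [localRepVec_apply, lp.coeFn_sum, Finset.sum_apply, lp.coeFn_smul, Pi.smul_apply,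
    spliceVec_apply, smul_eq_mul, mul_ite, mul_zero, Finset.sum_ite_eq, Finset.mem_univ, if_true]

/-- **A crude operator bound** (proved): `‖(A ⊗ 𝟙) ψ‖ ≤ (∑_{τ,τ'} ‖A τ' τ‖) ‖ψ‖`, from
`localRepVec_eq_sum`, the triangle inequality and `norm_spliceVec_le`. This suffices to make
`π_Λ(A)` a bounded operator; the sharp bound `‖A‖` is `norm_localRepFun_le`.
Guichardet (1966); Bratteli–Robinson II §6.2.1. [cite: Guichardet1966] -/
theorem norm_localRepVec_le_sum (Λ : Finset (Site d)) (A : Literature.MathematicalPhysics.QuantumLattice.Op ↥Λ q) (ψ : GuichardetSpace d q) :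
    ‖localRepVec Λ A ψ‖ ≤ (∑ τ : (↥Λ → Fin q), ∑ τ' : (↥Λ → Fin q), ‖A τ' τ‖) * ‖ψ‖ := by
  rw [localRepVec_eq_sum, Finset.sum_mul]
  refine (norm_sum_le _ _).trans (Finset.sum_le_sum fun τ _ => ?_)
  rw [Finset.sum_mul]
  refine (norm_sum_le _ _).trans (Finset.sum_le_sum fun τ' _ => ?_)
  rw [norm_smul]
  exact mul_le_mul_of_nonneg_left (norm_spliceVec_le Λ τ τ' ψ) (norm_nonneg _)

/-! #### The sharp bound `‖(A ⊗ 𝟙) ψ‖ ≤ ‖A‖ ‖ψ‖` (discharge of `norm_localRepFun_le`)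

Guichardet (1966) §1.4 (p. 12): for `H = H_Λ ⊗ H_{Λᶜ}` (associativity of the infinite tensor
product, §1.1, and `⊗_i ℓ²(X_i) ≅ ℓ²(X)` for the restricted product `X`, Cor. 1.1) the map
`T ↦ T̃ = T ⊗ 1` is an isomorphism of `𝓛(H_Λ)` onto a von Neumann algebra in `H`, in particular
`‖T ⊗ 1‖ = ‖T‖`. Concretely: `ℓ²(FinSuppConfig d q) = ⊕_ρ ℓ²(fibre of ρ)` over the configurations
`ρ` with `ρ|_Λ ≡ 0`, each fibre `{ρ.splice Λ τ | τ}` is a copy of the index set `↥Λ → Fin q` of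
`𝓗_Λ = ℂ^(↥Λ → Fin q)`, and on it `A ⊗ 𝟙` acts as the matrix `A`, whose Euclidean operator norm
is the `L²`-operator norm `‖A‖` (`Matrix.l2_opNorm_mulVec`). -/

/-- **Fibrewise summation**: if every `ρ ∈ R` is a fibre representative (`ρ|_Λ ≡ 0`, i.e.
`ρ.splice Λ 0 = ρ`), then the fibres `{ρ.splice Λ τ | τ}` of distinct `ρ ∈ R` are disjoint,
each is parametrised injectively by `τ`, and a sum over their union is the iterated sum.
Guichardet (1966) §1.1 (associativity `H = H_Λ ⊗ H_{Λᶜ}`), Cor. 1.1. [cite: Guichardet1966, §1.1 and Cor. 1.1] -/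
theorem sum_biUnion_fibre_eq {M : Type*} [AddCommMonoid M] (Λ : Finset (Site d))
    (R : Finset (FinSuppConfig d q)) (hR : ∀ ρ ∈ R, ρ.splice Λ 0 = ρ)
    (g : FinSuppConfig d q → M) :
    ∑ σ ∈ R.biUnion (fun ρ => (univ : Finset (↥Λ → Fin q)).image fun τ => ρ.splice Λ τ), g σ =
      ∑ ρ ∈ R, ∑ τ : (↥Λ → Fin q), g (ρ.splice Λ τ) := by
  rw [Finset.sum_biUnion]
  · refine Finset.sum_congr rfl fun ρ _ => ?_
    rw [Finset.sum_image]
    intro τ₁ _ τ₂ _ h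
    have h' : ρ.splice Λ τ₁ = ρ.splice Λ τ₂ := h
    rw [← FinSuppConfig.restrict_splice Λ τ₁ ρ, h', FinSuppConfig.restrict_splice]
  · intro ρ₁ h₁ ρ₂ h₂ hne
    simp only [Function.onFun, Finset.disjoint_left, Finset.mem_image, Finset.mem_univ,
      true_and]
    rintro σ ⟨τ₁, rfl⟩ ⟨τ₂, h⟩
    apply hne
    have h' := congrArg (fun σ : FinSuppConfig d q => σ.splice Λ 0) h
    simp only [FinSuppConfig.splice_splice] at h'
    rw [hR ρ₁ (Finset.mem_coe.1 h₁), hR ρ₂ (Finset.mem_coe.1 h₂)] at h'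
    exact h'.symm

/-- **On each fibre `A ⊗ 𝟙` acts as `A`**: `∑_{τ'} ‖(A ⊗ 𝟙)ψ (ρ.splice Λ τ')‖² = ‖A v_ρ‖²
≤ ‖A‖² ‖v_ρ‖² = ‖A‖² ∑_τ ‖ψ (ρ.splice Λ τ)‖²`, where `v_ρ τ = ψ (ρ.splice Λ τ) ∈ ℂ^(↥Λ → Fin q)`
and `‖A‖` is the `L²`-operator norm. Guichardet (1966) §1.4 (`T̃ = T ⊗ 1`);
Bratteli–Robinson II §6.2.1. [cite: Guichardet1966, §1.4] -/
theorem sum_fibre_norm_localRepVec_sq_le (Λ : Finset (Site d))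
    (A : Literature.MathematicalPhysics.QuantumLattice.Op ↥Λ q) (ψ : GuichardetSpace d q)
    (ρ : FinSuppConfig d q) :
    ∑ τ' : (↥Λ → Fin q), ‖localRepVec Λ A ψ (ρ.splice Λ τ')‖ ^ 2 ≤
      ‖A‖ ^ 2 * ∑ τ : (↥Λ → Fin q), ‖ψ (ρ.splice Λ τ)‖ ^ 2 := by
  set v : EuclideanSpace ℂ (↥Λ → Fin q) := WithLp.toLp 2 (fun τ => ψ (ρ.splice Λ τ)) with hv
  have hAv := Matrix.l2_opNorm_mulVec A v
  have hv2 : ‖v‖ ^ 2 = ∑ τ : (↥Λ → Fin q), ‖ψ (ρ.splice Λ τ)‖ ^ 2 := by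
    rw [EuclideanSpace.norm_sq_eq]
  have hAv2 : ‖(EuclideanSpace.equiv (↥Λ → Fin q) ℂ).symm (A *ᵥ v)‖ ^ 2 =
      ∑ τ' : (↥Λ → Fin q), ‖localRepVec Λ A ψ (ρ.splice Λ τ')‖ ^ 2 := by
    rw [EuclideanSpace.norm_sq_eq]
    refine Finset.sum_congr rfl fun τ' _ => ?_
    congr 2
    simp only [PiLp.continuousLinearEquiv_symm_apply, PiLp.toLp_apply, Matrix.mulVec,
      dotProduct, hv, localRepVec_apply, FinSuppConfig.restrict_splice,
      FinSuppConfig.splice_splice]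
  rw [← hAv2, ← hv2, ← mul_pow]
  exact pow_le_pow_left₀ (norm_nonneg _) hAv 2

/-- **Boundedness of `A ⊗ 𝟙` with the sharp constant** (discharge of the named fact
`norm_localRepFun_le`): `‖(A ⊗ 𝟙) ψ‖ ≤ ‖A‖ ‖ψ‖` for the `L²`-operator norm of `A ∈ 𝔄_Λ`.
Proof: saturate a finite set of configurations into complete `Λ`-fibres, apply
`sum_fibre_norm_localRepVec_sq_le` on each fibre and resum (`sum_biUnion_fibre_eq`), then
`lp.norm_le_of_forall_sum_le`. Guichardet (1966) §1.4, p. 12 (`T ↦ T ⊗ 1` is an isomorphism of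
`𝓛(H_j)` onto a von Neumann algebra in `H = ⊗ H_i`, hence isometric), with §1.1
(associativity) and Cor. 1.1 (`⊗ ℓ²(X_i) = ℓ²` of the restricted product);
Bratteli–Robinson II §6.2.1. [cite: Guichardet1966, §1.4] -/
theorem norm_localRepFun_le_holds : norm_localRepFun_le (d := d) (q := q) := by
  intro Λ A ψ
  have hp : 0 < (2 : ℝ≥0∞).toReal := by norm_num
  have h2 : (2 : ℝ≥0∞).toReal = 2 := by norm_num
  refine lp.norm_le_of_forall_sum_le hp (by positivity) fun s => ?_
  have hψ := lp.sum_rpow_le_norm_rpow hp ψ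
  rw [h2] at hψ ⊢
  simp only [Real.rpow_two] at hψ ⊢
  -- saturate `s` into complete fibres
  set R : Finset (FinSuppConfig d q) := s.image fun σ => σ.splice Λ 0 with hRdef
  set s' : Finset (FinSuppConfig d q) :=
    R.biUnion (fun ρ => (univ : Finset (↥Λ → Fin q)).image fun τ => ρ.splice Λ τ) with hs'def
  have hR : ∀ ρ ∈ R, ρ.splice Λ 0 = ρ := by
    intro ρ hρ
    obtain ⟨σ, -, rfl⟩ := Finset.mem_image.1 hρ
    exact FinSuppConfig.splice_splice Λ _ _ σ
  have hss' : s ⊆ s' := by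
    intro σ hσ
    refine Finset.mem_biUnion.2 ⟨σ.splice Λ 0, Finset.mem_image_of_mem _ hσ, ?_⟩
    refine Finset.mem_image.2 ⟨σ.restrict Λ, Finset.mem_univ _, ?_⟩
    rw [FinSuppConfig.splice_splice, FinSuppConfig.splice_restrict]
  calc ∑ σ ∈ s, ‖localRepVec Λ A ψ σ‖ ^ 2
      ≤ ∑ σ ∈ s', ‖localRepVec Λ A ψ σ‖ ^ 2 :=
        Finset.sum_le_sum_of_subset_of_nonneg hss' fun _ _ _ => by positivity
    _ = ∑ ρ ∈ R, ∑ τ' : (↥Λ → Fin q), ‖localRepVec Λ A ψ (ρ.splice Λ τ')‖ ^ 2 :=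
        sum_biUnion_fibre_eq Λ R hR _
    _ ≤ ∑ ρ ∈ R, ‖A‖ ^ 2 * ∑ τ : (↥Λ → Fin q), ‖ψ (ρ.splice Λ τ)‖ ^ 2 :=
        Finset.sum_le_sum fun ρ _ => sum_fibre_norm_localRepVec_sq_le Λ A ψ ρ
    _ = ‖A‖ ^ 2 * ∑ σ ∈ s', ‖ψ σ‖ ^ 2 := by
        rw [← Finset.mul_sum, sum_biUnion_fibre_eq Λ R hR fun σ => ‖ψ σ‖ ^ 2]
    _ ≤ ‖A‖ ^ 2 * ‖ψ‖ ^ 2 := mul_le_mul_of_nonneg_left (hψ s') (sq_nonneg _)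
    _ = (‖A‖ * ‖ψ‖) ^ 2 := (mul_pow _ _ _).symm

/-- `π_Λ(A) = A ⊗ 𝟙_{Λᶜ} ∈ B(𝓗)` as a bounded operator (`LinearMap.mkContinuousOfExistsBound` with
the proved bound `norm_localRepVec_le_sum`; the sharp bound is `norm_localRepFun_le`).
Bratteli–Robinson II §6.2.1. [folklore] -/
def localRepCLM (Λ : Finset (Site d)) (A : Literature.MathematicalPhysics.QuantumLattice.Op ↥Λ q) :
    GuichardetSpace d q →L[ℂ] GuichardetSpace d q :=
  (localRepLin Λ A).mkContinuousOfExistsBound ⟨_, norm_localRepVec_le_sum Λ A⟩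

/-- Coordinates of `π_Λ(A) ψ` (definitional). Bratteli–Robinson II §6.2.1. [folklore] -/
@[simp]
theorem localRepCLM_apply (Λ : Finset (Site d)) (A : Literature.MathematicalPhysics.QuantumLattice.Op ↥Λ q) (ψ : GuichardetSpace d q)
    (σ : FinSuppConfig d q) :
    localRepCLM Λ A ψ σ = ∑ τ : (↥Λ → Fin q), A (σ.restrict Λ) τ * ψ (σ.splice Λ τ) := rfl

/-- `π_Λ(1) = 1`. Bratteli–Robinson II §6.2.1. [folklore] -/
theorem localRep_map_one' (Λ : Finset (Site d)) : localRepCLM Λ (1 : Literature.MathematicalPhysics.QuantumLattice.Op ↥Λ q) = 1 := by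
  ext ψ σ
  simp only [localRepCLM_apply, Matrix.one_apply, ite_mul,
    one_mul, zero_mul, Finset.sum_ite_eq, Finset.mem_univ, if_true,
    FinSuppConfig.splice_restrict]
  rfl

/-- `π_Λ(AB) = π_Λ(A) π_Λ(B)`. Bratteli–Robinson II §6.2.1. [folklore] -/
theorem localRep_map_mul' (Λ : Finset (Site d)) (A B : Literature.MathematicalPhysics.QuantumLattice.Op ↥Λ q) :
    localRepCLM Λ (A * B) = localRepCLM Λ A * localRepCLM Λ B := by
  ext ψ σ
  rw [ContinuousLinearMap.mul_def, ContinuousLinearMap.comp_apply]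
  simp only [localRepCLM_apply, Matrix.mul_apply, Finset.sum_mul, Finset.mul_sum,
    FinSuppConfig.restrict_splice, FinSuppConfig.splice_splice, mul_assoc]
  rw [Finset.sum_comm]

/-- `π_Λ(0) = 0`. Bratteli–Robinson II §6.2.1. [folklore] -/
theorem localRep_map_zero' (Λ : Finset (Site d)) : localRepCLM Λ (0 : Literature.MathematicalPhysics.QuantumLattice.Op ↥Λ q) = 0 := by
  ext ψ σ
  simp

/-- `π_Λ(A + B) = π_Λ(A) + π_Λ(B)`. Bratteli–Robinson II §6.2.1. [folklore] -/
theorem localRep_map_add' (Λ : Finset (Site d)) (A B : Literature.MathematicalPhysics.QuantumLattice.Op ↥Λ q) :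
    localRepCLM Λ (A + B) = localRepCLM Λ A + localRepCLM Λ B := by
  ext ψ σ
  simp [add_mul, Finset.sum_add_distrib]

/-- `π_Λ(c • A) = c • π_Λ(A)`. Bratteli–Robinson II §6.2.1. [folklore] -/
theorem localRep_map_smul' (Λ : Finset (Site d)) (c : ℂ) (A : Literature.MathematicalPhysics.QuantumLattice.Op ↥Λ q) :
    localRepCLM Λ (c • A) = c • localRepCLM Λ A := by
  ext ψ σ
  simp [Finset.mul_sum, mul_assoc]

/-- `π_Λ(Aᴴ) = π_Λ(A)⋆` (adjoint in `B(𝓗)`). Bratteli–Robinson II §6.2.1. [cite: BratteliRobinsonII1997, §6.2.1] -/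
def localRep_map_star' : Prop :=
  ∀ (Λ : Finset (Site d)) (A : Literature.MathematicalPhysics.QuantumLattice.Op ↥Λ q),
    localRepCLM Λ (star A) = star (localRepCLM Λ A)

/-- `π_Λ` is injective on the underlying operators (`q ≥ 1`: evaluate on product vectors).
Bratteli–Robinson II §6.2.1. [cite: BratteliRobinsonII1997, §6.2.1] -/
def localRep_injective : Prop :=
  ∀ (Λ : Finset (Site d)),
    Function.Injective (localRepCLM (d := d) (q := q) Λ)

/-- **Isotony/compatibility**: `π_{Λ'} (A ⊗ 𝟙_{Λ'∖Λ}) = π_Λ (A)` for `Λ ⊆ Λ'` (the accepted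
`ι_compatible` field), on the underlying operators. Bratteli–Robinson II §6.2.1. [cite: BratteliRobinsonII1997, §6.2.1] -/
def localRep_compatible : Prop :=
  ∀ ⦃Λ Λ' : Finset (Site d)⦄ (h : Λ ⊆ Λ') (A : Literature.MathematicalPhysics.QuantumLattice.Op ↥Λ q),
    localRepCLM Λ' (Literature.MathematicalPhysics.QuantumLattice.embedOp h A) = localRepCLM Λ A

/-- **Locality**: `[π_Λ(A), π_{Λ'}(B)] = 0` for disjoint `Λ`, `Λ'`, on the underlying operators.
Bratteli–Robinson II §6.2.1. [cite: BratteliRobinsonII1997, §6.2.1] -/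
def localRep_commute_of_disjoint : Prop :=
  ∀ ⦃Λ Λ' : Finset (Site d)⦄ (h : Disjoint Λ Λ') (A : Literature.MathematicalPhysics.QuantumLattice.Op ↥Λ q) (B : Literature.MathematicalPhysics.QuantumLattice.Op ↥Λ' q),
    Commute (localRepCLM Λ A) (localRepCLM Λ' B)

-- Standing hypothesis of the rest of the file: `π_Λ` preserves adjoints
-- (`localRep_map_star'`), needed to package `π_Λ` as a ⋆-homomorphism.
variable (hstar : localRep_map_star' (d := d) (q := q))

/-- **The local representation** `π_Λ : 𝔄_Λ = Op ↥Λ q →⋆ₐ[ℂ] B(𝓗)`, `A ↦ A ⊗ 𝟙_{Λᶜ}`, a unital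
⋆-homomorphism (data `localRepCLM`; the algebraic obligations are the lemmas
`localRep_map_one'/mul'/zero'/add'/smul'`, and the ⋆-preservation hypothesis
`hstar : localRep_map_star'`). Bratteli–Robinson II §6.2.1;
Bratteli–Robinson I Example 2.6.12; Guichardet (1966). [cite: Guichardet1966] -/
def localRep (Λ : Finset (Site d)) :
    Literature.MathematicalPhysics.QuantumLattice.Op ↥Λ q →⋆ₐ[ℂ] (GuichardetSpace d q →L[ℂ] GuichardetSpace d q) where
  toFun := localRepCLM Λ
  map_one' := localRep_map_one' Λ
  map_mul' := localRep_map_mul' Λ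
  map_zero' := localRep_map_zero' Λ
  map_add' := localRep_map_add' Λ
  commutes' c := by
    rw [Algebra.algebraMap_eq_smul_one, Algebra.algebraMap_eq_smul_one, localRep_map_smul',
      localRep_map_one']
  map_star' := hstar Λ

/-- `localRep Λ A` is the operator `localRepCLM Λ A` (definitional). [folklore] -/
@[simp]
theorem localRep_apply (Λ : Finset (Site d)) (A : Literature.MathematicalPhysics.QuantumLattice.Op ↥Λ q) :
    localRep hstar Λ A = localRepCLM Λ A :=
  rfl

/-! ### The local algebra and the quasi-local C⋆-algebra -/

variable (d q)

/-- The ⋆-algebra `𝔄_loc = ⋃_Λ π_Λ(𝔄_Λ) ⊆ B(𝓗)` of **strictly local** operators (supremum of the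
ranges; the system is directed by `localRep_compatible`). Bratteli–Robinson I Def. 2.6.3;
Bratteli–Robinson II §6.2.1. [folklore] -/
def localAlgebra : StarSubalgebra ℂ (GuichardetSpace d q →L[ℂ] GuichardetSpace d q) :=
  ⨆ Λ : Finset (Site d), (localRep hstar Λ).range

/-- **The quasi-local (UHF) algebra** `𝔄 = norm-closure of 𝔄_loc` inside `B(𝓗)`, `𝓗` the
Guichardet space. Bratteli–Robinson I §2.6.1, Example 2.6.12; Bratteli–Robinson II §6.2.1;
Glimm (1960). [cite: Glimm1960] -/
def quasiLocalAlg : StarSubalgebra ℂ (GuichardetSpace d q →L[ℂ] GuichardetSpace d q) :=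
  (localAlgebra d q hstar).topologicalClosure

/-- The quasi-local algebra is norm closed in `B(𝓗)` (an instance of the `Prop`-class `IsClosed`
on our set, so that Mathlib's `StarSubalgebra.cstarAlgebra` applies). Bratteli–Robinson I
§2.6.1. [folklore] -/
instance isClosed_quasiLocalAlg :
    IsClosed ((quasiLocalAlg d q hstar : Set (GuichardetSpace d q →L[ℂ] GuichardetSpace d q))) :=
  StarSubalgebra.isClosed_topologicalClosure _

/-- Sanity check: `𝔄` is a C⋆-algebra through Mathlib's `StarSubalgebra.cstarAlgebra`. -/
example : CStarAlgebra ↥(quasiLocalAlg d q hstar) := inferInstance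

/-- Sanity check: `𝔄` inherits the Loewner order of `B(𝓗)` as a subtype. -/
example : PartialOrder ↥(quasiLocalAlg d q hstar) := inferInstance

/-- **The inherited Loewner order on `𝔄` is its C⋆-order**: `S ≤ T` in `B(𝓗)` for `S, T ∈ 𝔄`
iff `T - S ∈ closure {R⋆R | R ∈ 𝔄}` — spectral permanence: the positive square root of a
positive element of a norm-closed unital ⋆-subalgebra lies in it. Bratteli–Robinson I
Prop. 2.2.10 and §2.2.2; Mathlib has the statement for `B(𝓗)` itself
(`ContinuousLinearMap.instStarOrderedRing`). Not an instance (see the module docstring). [cite: BratteliRobinsonI1987, Prop. 2.2.10] -/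
def starOrderedRing_quasiLocalAlg : Prop :=
  StarOrderedRing ↥(quasiLocalAlg d q hstar)

variable {d q}

/-- Local operators lie in the local algebra. Bratteli–Robinson II §6.2.1. [folklore] -/
theorem localRep_mem_localAlgebra (Λ : Finset (Site d)) (A : Literature.MathematicalPhysics.QuantumLattice.Op ↥Λ q) :
    localRep hstar Λ A ∈ localAlgebra d q hstar :=
  (le_iSup (fun Λ' : Finset (Site d) => (localRep hstar Λ').range) Λ) ⟨A, rfl⟩

/-- Local operators lie in the quasi-local algebra. Bratteli–Robinson II §6.2.1. [folklore] -/
theorem localRep_mem_quasiLocalAlg (Λ : Finset (Site d)) (A : Literature.MathematicalPhysics.QuantumLattice.Op ↥Λ q) :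
    localRep hstar Λ A ∈ quasiLocalAlg d q hstar :=
  StarSubalgebra.le_topologicalClosure _ (localRep_mem_localAlgebra hstar Λ A)

/-- The local representation with values in `𝔄`: `ι_Λ = π_Λ : 𝔄_Λ →⋆ₐ[ℂ] 𝔄`
(`StarAlgHom.codRestrict`). Bratteli–Robinson II §6.2.1, eq. (6.2.1). [folklore] -/
def localRepCod (Λ : Finset (Site d)) : Literature.MathematicalPhysics.QuantumLattice.Op ↥Λ q →⋆ₐ[ℂ] ↥(quasiLocalAlg d q hstar) :=
  (localRep hstar Λ).codRestrict (quasiLocalAlg d q hstar) (localRep_mem_quasiLocalAlg hstar Λ)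

/-- `localRepCod` unfolded (definitional). [folklore] -/
@[simp]
theorem coe_localRepCod_apply (Λ : Finset (Site d)) (A : Literature.MathematicalPhysics.QuantumLattice.Op ↥Λ q) :
    (localRepCod hstar Λ A : GuichardetSpace d q →L[ℂ] GuichardetSpace d q) = localRep hstar Λ A :=
  rfl

/-- `ι_Λ` is injective (from the injectivity fact `localRep_injective`). Bratteli–Robinson II
§6.2.1. [folklore] -/
theorem localRepCod_injective (hinj : localRep_injective (d := d) (q := q))
    (Λ : Finset (Site d)) : Function.Injective (localRepCod hstar Λ) :=
  fun _ _ h => hinj Λ (congrArg Subtype.val h)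

variable (d q) in
/-- The local algebra is the union of the ranges of the `π_Λ` (the system is directed under
isotony, the hypothesis `hcompat : localRep_compatible`). Bratteli–Robinson I Def. 2.6.3;
Bratteli–Robinson II §6.2.1. [folklore] -/
theorem coe_localAlgebra (hcompat : localRep_compatible (d := d) (q := q)) :
    (localAlgebra d q hstar : Set (GuichardetSpace d q →L[ℂ] GuichardetSpace d q)) =
      ⋃ Λ : Finset (Site d), Set.range (localRep hstar Λ) := by
  have dir : Directed (· ≤ ·)
      fun Λ : Finset (Site d) => (localRep hstar Λ).range := by
    intro Λ₁ Λ₂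
    refine ⟨Λ₁ ∪ Λ₂, ?_, ?_⟩
    · rintro _ ⟨A, rfl⟩
      exact ⟨Literature.MathematicalPhysics.QuantumLattice.embedOp Finset.subset_union_left A, hcompat _ A⟩
    · rintro _ ⟨A, rfl⟩
      exact ⟨Literature.MathematicalPhysics.QuantumLattice.embedOp Finset.subset_union_right A, hcompat _ A⟩
  rw [localAlgebra, StarSubalgebra.coe_iSup_of_directed dir]
  rfl

variable (d q) in
/-- **The strictly local elements are dense in `𝔄`** (inside the subtype `↥𝔄`: `𝔄` is the closure
of `𝔄_loc`, and `𝔄_loc = ⋃_Λ range ι_Λ` since the system of ranges is directed by isotony).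
Bratteli–Robinson I Def. 2.6.3; Bratteli–Robinson II §6.2.1. [folklore] -/
theorem dense_iUnion_range_localRepCod (hcompat : localRep_compatible (d := d) (q := q)) :
    Dense (⋃ Λ : Finset (Site d), Set.range (localRepCod hstar Λ)) := by
  rw [Subtype.dense_iff]
  intro T hT
  have himg : ((↑) '' ⋃ Λ : Finset (Site d), Set.range (localRepCod hstar Λ)) =
      ⋃ Λ : Finset (Site d), Set.range (localRep hstar Λ) := by
    rw [Set.image_iUnion]
    refine Set.iUnion_congr fun Λ => ?_
    rw [← Set.range_comp]
    rfl
  have hT' : T ∈ closure (⋃ Λ : Finset (Site d), Set.range (localRep hstar Λ)) := by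
    rw [← coe_localAlgebra d q hstar hcompat]
    exact hT
  rw [← himg] at hT'
  exact hT'

/-! ### Lattice translations -/

/-- A vector of `𝓗` reindexed along a bijection of configurations is again in `ℓ²`.
von Neumann (1939). [cite: Neumann1939] -/
theorem memℓp_comp_equiv (e : FinSuppConfig d q ≃ FinSuppConfig d q) (ψ : GuichardetSpace d q) :
    Memℓp (fun σ => ψ (e σ)) 2 := by
  have hp : 0 < (2 : ℝ≥0∞).toReal := by norm_num
  exact memℓp_gen ((Equiv.summable_iff e).mpr ((lp.memℓp ψ).summable hp))

/-- **The translation unitaries** `U_v` on the Guichardet space, `(U_v ψ)(σ) = ψ(σ(· + v))`, i.e.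
`U_v δ_σ = δ_{σ(· - v)}` (permutation of the product basis along `FinSuppConfig.shift v`), a
linear isometric bijection. Bratteli–Robinson II §6.2.1, eq. (6.2.2). [folklore] -/
def shiftUnitary (v : Site d) : GuichardetSpace d q ≃ₗᵢ[ℂ] GuichardetSpace d q where
  toFun ψ := ⟨fun σ => ψ ((FinSuppConfig.shift v).symm σ), memℓp_comp_equiv _ ψ⟩
  invFun ψ := ⟨fun σ => ψ (FinSuppConfig.shift v σ), memℓp_comp_equiv _ ψ⟩
  map_add' ψ ψ' := by ext σ; rfl
  map_smul' c ψ := by ext σ; rfl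
  left_inv ψ := by ext σ; simp
  right_inv ψ := by ext σ; simp
  norm_map' ψ := by
    have hp : 0 < (2 : ℝ≥0∞).toReal := by norm_num
    rw [lp.norm_eq_tsum_rpow hp, lp.norm_eq_tsum_rpow hp]
    congr 1
    exact Equiv.tsum_eq (FinSuppConfig.shift v).symm fun σ => ‖ψ σ‖ ^ (2 : ℝ≥0∞).toReal

/-- `U_v` unfolded (definitional). Bratteli–Robinson II §6.2.1. [folklore] -/
@[simp]
theorem shiftUnitary_apply (v : Site d) (ψ : GuichardetSpace d q) (σ : FinSuppConfig d q) :
    shiftUnitary v ψ σ = ψ ((FinSuppConfig.shift v).symm σ) := rfl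

/-- `U_v⁻¹` unfolded (definitional). Bratteli–Robinson II §6.2.1. [folklore] -/
@[simp]
theorem shiftUnitary_symm_apply (v : Site d) (ψ : GuichardetSpace d q) (σ : FinSuppConfig d q) :
    (shiftUnitary v).symm ψ σ = ψ (FinSuppConfig.shift v σ) := rfl

/-- **Translations preserve the quasi-local algebra**: `U_v 𝔄 U_v⋆ ⊆ 𝔄` (conjugation maps
`π_Λ(𝔄_Λ)` onto `π_{Λ+v}(𝔄_{Λ+v})`, cf. `shiftAut_localRepCod`, and is continuous).
Bratteli–Robinson II §6.2.1, eq. (6.2.2). [cite: BratteliRobinsonII1997, §6.2.1 eq. (6.2.2)] -/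
def shift_mem_quasiLocalAlg : Prop :=
  ∀ (v : Site d) {T : GuichardetSpace d q →L[ℂ] GuichardetSpace d q}
    (hT : T ∈ quasiLocalAlg d q hstar),
    (shiftUnitary v).conjStarAlgEquiv T ∈ quasiLocalAlg d q hstar

/-- `U_v⁻¹ = U_{-v}`. Bratteli–Robinson II §6.2.1. [folklore] -/
theorem shiftUnitary_symm (v : Site d) :
    (shiftUnitary (d := d) (q := q) v).symm = shiftUnitary (-v) := by
  ext ψ σ
  rfl

/-- `U_v⋆ 𝔄 U_v ⊆ 𝔄` (from the hypothesis `hshift : shift_mem_quasiLocalAlg`).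
Bratteli–Robinson II §6.2.1, eq. (6.2.2). [folklore] -/
theorem shift_symm_mem_quasiLocalAlg (hshift : shift_mem_quasiLocalAlg hstar) (v : Site d)
    {T : GuichardetSpace d q →L[ℂ] GuichardetSpace d q} (hT : T ∈ quasiLocalAlg d q hstar) :
    (shiftUnitary v).conjStarAlgEquiv.symm T ∈ quasiLocalAlg d q hstar := by
  rw [LinearIsometryEquiv.symm_conjStarAlgEquiv, shiftUnitary_symm]
  exact hshift (-v) hT

/-- **The translation automorphisms** `τ_v ∈ Aut(𝔄)`, `τ_v(T) = U_v T U_v⋆` (Mathlib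
`LinearIsometryEquiv.conjStarAlgEquiv` restricted to `𝔄`; the invariance obligation is the
hypothesis `hshift : shift_mem_quasiLocalAlg`). Bratteli–Robinson II §6.2.1, eq. (6.2.2). [folklore] -/
def shiftAut (hshift : shift_mem_quasiLocalAlg hstar) (v : Site d) :
    ↥(quasiLocalAlg d q hstar) ≃⋆ₐ[ℂ] ↥(quasiLocalAlg d q hstar) :=
  let e : (GuichardetSpace d q →L[ℂ] GuichardetSpace d q) ≃⋆ₐ[ℂ]
      (GuichardetSpace d q →L[ℂ] GuichardetSpace d q) := (shiftUnitary v).conjStarAlgEquiv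
  { toFun := fun T => ⟨e T.1, hshift v T.2⟩
    invFun := fun T => ⟨e.symm T.1, shift_symm_mem_quasiLocalAlg hstar hshift v T.2⟩
    left_inv := fun T => Subtype.ext (e.symm_apply_apply T.1)
    right_inv := fun T => Subtype.ext (e.apply_symm_apply T.1)
    map_mul' := fun S T => Subtype.ext (map_mul e S.1 T.1)
    map_add' := fun S T => Subtype.ext (map_add e S.1 T.1)
    map_star' := fun T => Subtype.ext (map_star e T.1)
    map_smul' := fun c T => Subtype.ext (map_smul e c T.1) }

/-- `τ_v` unfolded (definitional). Bratteli–Robinson II §6.2.1. [folklore] -/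
@[simp]
theorem coe_shiftAut_apply (hshift : shift_mem_quasiLocalAlg hstar) (v : Site d)
    (T : ↥(quasiLocalAlg d q hstar)) :
    (shiftAut hstar hshift v T : GuichardetSpace d q →L[ℂ] GuichardetSpace d q) =
      (shiftUnitary (d := d) (q := q) v : GuichardetSpace d q →L[ℂ] GuichardetSpace d q) ∘L T ∘L
        ((shiftUnitary (d := d) (q := q) v).symm :
          GuichardetSpace d q →L[ℂ] GuichardetSpace d q) := rfl

/-- **Covariance of the local structure**: `τ_v (ι_Λ A) = ι_{Λ+v} (A relabelled along x ↦ x + v)`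
(the accepted `shift_ι` field). Bratteli–Robinson II §6.2.1, eq. (6.2.2). [cite: BratteliRobinsonII1997, §6.2.1 eq. (6.2.2)] -/
def shiftAut_localRepCod (hshift : shift_mem_quasiLocalAlg hstar) : Prop :=
  ∀ (v : Site d) (Λ : Finset (Site d)) (A : Literature.MathematicalPhysics.QuantumLattice.Op ↥Λ q),
    shiftAut hstar hshift v (localRepCod hstar Λ A) =
      localRepCod hstar (Λ.map (Site.shift v).toEmbedding)
      (Literature.MathematicalPhysics.QuantumLattice.transportOp (Literature.MathematicalPhysics.QuantumLattice.finsetMapEquiv (Site.shift v).toEmbedding Λ) A)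

/-! ### The UHF algebra as a `QuasiLocalAlgebra` -/

variable (d q)

/-- **The concrete quasi-local algebra** on the Guichardet space packages into the accepted
hypothesis structure `QuasiLocalAlgebra d q`: carrier `𝔄 = quasiLocalAlg d q` with the
inherited Loewner order (`sor` from the fact `starOrderedRing_quasiLocalAlg`), `ι := localRepCod`,
`shift := shiftAut`. The data are real; the Prop obligations not proved in this file enter as the
explicit hypotheses `hstar`, `hinj`, `hcompat`, `hcomm`, `hshift`, `hsor`, `hshiftι` (the named
facts `localRep_map_star'`, `localRep_injective`, `localRep_compatible`,
`localRep_commute_of_disjoint`, `shift_mem_quasiLocalAlg`, `starOrderedRing_quasiLocalAlg`,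
`shiftAut_localRepCod`). Bratteli–Robinson I §2.6.1, Example 2.6.12; Bratteli–Robinson II
§6.2.1; Guichardet (1966). [cite: Guichardet1966] -/
def uhfQuasiLocalAlgebra (hinj : localRep_injective (d := d) (q := q))
    (hcompat : localRep_compatible (d := d) (q := q))
    (hcomm : localRep_commute_of_disjoint (d := d) (q := q))
    (hshift : shift_mem_quasiLocalAlg hstar) (hsor : starOrderedRing_quasiLocalAlg d q hstar)
    (hshiftι : shiftAut_localRepCod hstar hshift) : Literature.MathematicalPhysics.QuantumLattice.QuasiLocalAlgebra d q :=
  { carrier := ↥(quasiLocalAlg d q hstar)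
    sor := hsor
    ι := localRepCod hstar
    ι_injective := localRepCod_injective hstar hinj
    ι_compatible := fun _ _ h A => Subtype.ext (hcompat h A)
    ι_commute_of_disjoint := fun _ _ h A B => Subtype.ext (hcomm h A B).eq
    dense_range := dense_iUnion_range_localRepCod d q hstar hcompat
    shift := shiftAut hstar hshift
    shift_ι := hshiftι }

/-- **Existence of the quasi-local algebra** from the UHF construction on the Guichardet space,
conditional on the analytic facts `hstar`, `hinj`, `hcompat`, `hcomm`, `hshift`, `hsor`, `hshiftι`
(see `uhfQuasiLocalAlgebra`). Glimm (1960); Bratteli–Robinson I Example 2.6.12;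
Bratteli–Robinson II §6.2.1. [cite: Glimm1960] -/
theorem nonempty_quasiLocalAlgebra_of_uhf (hinj : localRep_injective (d := d) (q := q))
    (hcompat : localRep_compatible (d := d) (q := q))
    (hcomm : localRep_commute_of_disjoint (d := d) (q := q))
    (hshift : shift_mem_quasiLocalAlg hstar) (hsor : starOrderedRing_quasiLocalAlg d q hstar)
    (hshiftι : shiftAut_localRepCod hstar hshift) : Nonempty (Literature.MathematicalPhysics.QuantumLattice.QuasiLocalAlgebra d q) :=
  ⟨uhfQuasiLocalAlgebra d q hstar hinj hcompat hcomm hshift hsor hshiftι⟩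

/-! ### Vector states and the vacuum -/

variable {d q}

/-- **Vector states** `ω_ψ(T) = ⟪ψ, T ψ⟫` on `𝔄` for a unit vector `ψ ∈ 𝓗` (positivity for the
inherited Loewner order: `⟪ψ, T ψ⟫ ≥ 0` for positive `T`). Bratteli–Robinson I §2.3.2 (vector
states), Thm. 2.3.16; Bratteli–Robinson II §6.2.1. [folklore] -/
def vectorState (ψ : GuichardetSpace d q) (hψ : ‖ψ‖ = 1) : Literature.MathematicalPhysics.QuantumLattice.State ↥(quasiLocalAlg d q hstar) where
  toPositiveLinearMap :=
    { toFun := fun T => ⟪ψ, (T : GuichardetSpace d q →L[ℂ] GuichardetSpace d q) ψ⟫_ℂ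
      map_add' := fun S T => by simp
      map_smul' := fun c T => by simp
      monotone' := by
        intro S T hST
        have h : ((T : GuichardetSpace d q →L[ℂ] GuichardetSpace d q) - S).IsPositive :=
          (ContinuousLinearMap.le_def _ _).mp hST
        have h0 := h.inner_nonneg_right ψ
        rw [_root_.sub_apply, inner_sub_right, sub_nonneg] at h0
        exact h0 }
  map_one' := by
    change ⟪ψ, (1 : GuichardetSpace d q →L[ℂ] GuichardetSpace d q) ψ⟫_ℂ = 1
    rw [one_apply_eq_self, inner_self_eq_norm_sq_to_K, hψ]
    simp

/-- `ω_ψ(T) = ⟪ψ, T ψ⟫` (definitional). Bratteli–Robinson I §2.3.2. [folklore] -/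
@[simp]
theorem vectorState_apply (ψ : GuichardetSpace d q) (hψ : ‖ψ‖ = 1)
    (T : ↥(quasiLocalAlg d q hstar)) :
    vectorState hstar ψ hψ T = ⟪ψ, (T : GuichardetSpace d q →L[ℂ] GuichardetSpace d q) ψ⟫_ℂ :=
  rfl

variable (d q)

/-- **The vacuum (infinite product) state** `ω_Ω = ⊗_x ⟨e₀, · e₀⟩` on `𝔄`, the vector state of
`Ω = ⊗ e₀`. von Neumann (1939); Bratteli–Robinson I Example 2.6.12; Bratteli–Robinson II
§6.2.1 (product states). [cite: Neumann1939] -/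
def vacuumState : Literature.MathematicalPhysics.QuantumLattice.State ↥(quasiLocalAlg d q hstar) :=
  vectorState hstar (vacuumVector d q) (norm_vacuumVector d q)

/-- The vacuum product state is pure (the Guichardet-space representation of the UHF algebra is
irreducible). Bratteli–Robinson I Example 2.6.12, Thm. 2.3.19; Guichardet (1966). Stated for
the C⋆-order of `𝔄` (the fact `starOrderedRing_quasiLocalAlg`) as an instance hypothesis. [cite: Guichardet1966] -/
def vacuumState_isPure : Prop :=
  ∀ [StarOrderedRing ↥(quasiLocalAlg d q hstar)], Literature.MathematicalPhysics.QuantumLattice.IsPureState (vacuumState d q hstar)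

/-- **Glimm's theorem**: the UHF algebra `𝔄` is simple (no non-trivial closed — indeed no
non-trivial — two-sided ideals). Glimm (1960) Thm. 5.1; Bratteli–Robinson I Cor. 2.6.19 (ii). [cite: Glimm1960] -/
def isSimpleRing_quasiLocalAlg : Prop :=
  IsSimpleRing ↥(quasiLocalAlg d q hstar)

end QLattice

end Literature.Analysis.FunctionSpaces
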